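import Literature.Geometry.Symplectic.JHolomorphicMap
import Mathlib.Geometry.Manifold.MFDeriv.Basic
import Mathlib.Geometry.Manifold.Instances.Real
import Mathlib.Topology.UniformSpace.UniformConvergence

/-!
# Limits of embedded `J`-holomorphic planes are embedded (McDuff 1991, §4)

A NAMED FACT of the local theory of `J`-holomorphic curves in almost complex 4-manifolds:

* `Literature.Geometry.Symplectic.jHolomorphicLimitOfEmbedded_isEmbedded` — if smooth
  `J`-holomorphic injective immersions `uₙ : ℂ → V` into a smooth almost complex `4`-manifold
  `(V, J)` converge uniformly on compact sets to a smooth `J`-holomorphic `G : ℂ → V` which is an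
  injective immersion on an annulus `r₀ < |ξ| < r₁` mapped disjointly from the disc `|ξ| ≤ r₀`,
  then `G` is an injective immersion on the disc `|ξ| < r₁`.

This is the form in which McDuff's conservation of the self-intersection index under `C¹`-small
perturbation (Lemma 4.3) and the positivity of all singular contributions (Thms 1.1, 1.4) enter
Gromov's pencil arguments (limits of pencil members are embedded); it is consumed by the crux
`WitnessCharge` of summit `SmoothPoincare4` (line `Sketch`, stub `substub_limitEmbedded`) and is
the same input as for `TameOrBrodyR4` / `GromovRecognitionRelEnd`.

Sources: D. McDuff, *The local behaviour of holomorphic curves in almost complex 4-manifolds*,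
J. Differential Geom. 34 (1991) 143–164 — Def. 4.1 and Lemma 4.2(i) (pp. 158–159), Lemma 4.3
(p. 159: "If `f'` is sufficiently `C¹`-close to `f`, then the singularities of `f'` all lie in the
interior of `D` and `Int(f') = Int(f)`. In particular, `Int(f)` is a nonnegative integer."),
Cor. 4.4 (p. 160), Thm 1.1 (p. 143), Thm 1.4 (p. 144), proof of Thm 1.3 ((5.5), p. 163).
The `C¹`-closeness is obtained from `C⁰`-convergence of `J`-holomorphic maps by interior elliptic
regularity (C. Hummel, *Gromov's compactness theorem for pseudo-holomorphic curves* (1997), Ch. III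
Prop. 3.1; in the tree as `Literature.Geometry.Symplectic.JHolomorphicWeierstrassR4`, discharged).

Design: convergence of maps into the abstract manifold `V` is expressed through an auxiliary
topological embedding `ι : V → ℝᴺ` which is a smooth injective immersion (for the consumers, the
restriction of a Whitney embedding of a compact manifold); the statement is for entire maps
`ℂ → V`, the case used by pencil arguments. Deliberately NOT here: the self-intersection index
`Int(f)` itself, positivity of intersections of two distinct curves (Thm 1.1 in full), the
adjunction formula (Thm 1.3).
-/

noncomputable section

open scoped Manifold ContDiff
open Set Filter _root_.Topology

namespace Literature.Geometry.Symplectic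

/-- **McDuff (1991): a locally uniform limit of embedded `J`-holomorphic planes which is embedded
on a collar separating a disc from the rest is embedded on the disc.** Let `(V, J)` be a smooth
almost complex `4`-manifold (`J² = -1`, `J` smooth in tangent coordinates), `ι : V → ℝᴺ` a
topological embedding which is a smooth injective immersion (only used to express convergence).
Let `uₙ : ℂ → V` be smooth `J`-holomorphic injective immersions converging uniformly on compact
sets (through `ι`) to a smooth `J`-holomorphic `G : ℂ → V`, and suppose `G` is an injective
immersion on the annulus `r₀ < |ξ| < r₁` and maps it disjointly from the disc `|ξ| ≤ r₀`. Then `G`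
is an injective immersion on the disc `|ξ| < r₁`. Proof in the source: on `D = {|ξ| ≤ r}`,
`r₀ < r < r₁`, `G` embeds a collar `A` with `G⁻¹(G(A)) ∩ D = A` (Def. 4.1), so `Int(G|D)` is
defined; the embeddings `uₙ|D` are `C¹`-close to `G|D` for `n` large (interior elliptic
regularity, Hummel 1997 III.3.1, upgrades the `C⁰`-convergence), hence `Int(G|D) = Int(uₙ|D) = 0`
(Lemma 4.3, Lemma 4.2(i)); `G|D` is not multiply covered (it is injective on the collar), and every
critical point and every double point of such a map contributes positively to `Int` (Thm 1.4,
Thm 1.1, assembled as in (5.5)), so there are none.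
-- TODO(general form): McDuff's Lemma 4.3 is for maps of the closed disc and ONE `J`-holomorphic
-- immersion `f'` sufficiently `C¹`-close to `f`, with the conclusion `Int(f') = Int(f)`.
[cite: McDuff1991LocalBehaviour, Lemma 4.3, Lemma 4.2(i), Thm 1.1, Thm 1.4, (5.5)] -/
def jHolomorphicLimitOfEmbedded_isEmbedded : Prop :=
  ∀ (V : Type) [TopologicalSpace V] [T2Space V] [SecondCountableTopology V]
    [ChartedSpace (EuclideanSpace ℝ (Fin 4)) V] [IsManifold (𝓡 4) ∞ V]
    (J : ∀ x : V, TangentSpace (𝓡 4) x →L[ℝ] TangentSpace (𝓡 4) x),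
    (∀ (x : V) (v : TangentSpace (𝓡 4) x), J x (J x v) = -v) →
    (∀ x₀ : V, ContMDiffAt (𝓡 4) 𝓘(ℝ, EuclideanSpace ℝ (Fin 4) →L[ℝ] EuclideanSpace ℝ (Fin 4)) ∞
      (inTangentCoordinates (𝓡 4) (𝓡 4) (id : V → V) id (fun x => J x) x₀) x₀) →
    ∀ (N : ℕ) (ι : V → EuclideanSpace ℝ (Fin N)), Topology.IsEmbedding ι →
      ContMDiff (𝓡 4) 𝓘(ℝ, EuclideanSpace ℝ (Fin N)) ∞ ι →
      (∀ x : V, Function.Injective (mfderiv (𝓡 4) 𝓘(ℝ, EuclideanSpace ℝ (Fin N)) ι x)) →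
    ∀ (u : ℕ → ℂ → V) (G : ℂ → V) (r₀ r₁ : ℝ), 0 < r₀ → r₀ < r₁ →
      (∀ n, ContMDiff 𝓘(ℝ, ℂ) (𝓡 4) ∞ (u n)) → (∀ n, IsJHolomorphic (𝓡 4) J (u n)) →
      (∀ n, Function.Injective (u n)) →
      (∀ n (ξ : ℂ), Function.Injective (mfderiv 𝓘(ℝ, ℂ) (𝓡 4) (u n) ξ)) →
      ContMDiff 𝓘(ℝ, ℂ) (𝓡 4) ∞ G → IsJHolomorphic (𝓡 4) J G →
      (∀ D : Set ℂ, IsCompact D →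
        TendstoUniformlyOn (fun n ζ => ι (u n ζ)) (fun ζ => ι (G ζ)) atTop D) →
      Set.InjOn G {ξ : ℂ | r₀ < ‖ξ‖ ∧ ‖ξ‖ < r₁} →
      (∀ ξ : ℂ, r₀ < ‖ξ‖ → ‖ξ‖ < r₁ → Function.Injective (mfderiv 𝓘(ℝ, ℂ) (𝓡 4) G ξ)) →
      (∀ ξ ξ' : ℂ, ‖ξ‖ ≤ r₀ → r₀ < ‖ξ'‖ → ‖ξ'‖ < r₁ → G ξ ≠ G ξ') →
      Set.InjOn G (Metric.ball (0 : ℂ) r₁) ∧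
        ∀ ξ ∈ Metric.ball (0 : ℂ) r₁, Function.Injective (mfderiv 𝓘(ℝ, ℂ) (𝓡 4) G ξ)

end Literature.Geometry.Symplectic
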